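import Summits.PneNP.PneNP.Theses.ExpanderLinearGenerators
import Summits.PneNP.PneNP.Theorems.ExpanderLinearGeneratorsLinearGeneratorModPFregeHardCalibration

/-!
# `LinearGeneratorModPFregeHard` is exercised from depth `30` on (stmt-PneNP-11444)

Route `PneNP/ExpanderLinearGenerators`, support rung `LinearGeneratorModPFregeHard` (the `AC⁰[p]`-Frege
rung, Krajíček 2019 Problem 15.6.1 on the XOR-CNFs of expanding linear maps).  This small file
records, against the decl itself, the upper end of the calibration proved in
`ExpanderLinearGeneratorsLinearGeneratorModPFregeHardCalibration.lean`: for `d ≥ 30` the rung's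
universally quantified proof `π` always exists (`exists_isModDepthProofOf_sumEncoding`), so under
the rung the bound `2^(n^ε)` is attained by an actual `F_d(MOD_p)` proof of the target — the rung
is a statement about existing objects, not an implication with an empty antecedent (contrast the
slices `d ≤ 4`, which are vacuous: `ExpanderLinearGeneratorsLinearGeneratorModPFregeHardLowDepth.lean`).

Reference: J. Krajíček, *Proof Complexity* (CUP 2019), Problem 15.6.1 [KrajicekProofComplexity2019].
-/

set_option linter.dupNamespace false -- `Summit.PneNP.PneNP.…`: summit = sub-problem (D-0017)

namespace Summit.PneNP.PneNP.Theorems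

open Literature.Computability.Complexity Literature.Computability.MetaComplexity

/-- **The rung is exercised from depth `30` on.** Under `LinearGeneratorModPFregeHard`, for every
odd prime `p`, locality `ℓ ≥ 1`, depth `d ≥ 30` and `0 < δ < 1`, the promised `ε, N` are such
that every qualifying (sparse, expanding, unsolvable) system `E` on `n ≥ N` variables HAS a
depth-`d` `textbookFrege(MOD_p)` proof of the target, of `modProofSize ≥ 2^(n^ε)`
(`exists_isModDepthProofOf_sumEncoding` feeds the rung's universally quantified `π`): the rung
is a statement about existing objects, not an implication with an empty antecedent.
[Krajíček 2019, Problem 15.6.1] [folklore] -/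
theorem linearGeneratorModPFregeHard_nonvacuous
    (h : Summit.PneNP.PneNP.Theses.ExpanderLinearGenerators.LinearGeneratorModPFregeHard) :
    ∀ (p : ℕ), p.Prime → p ≠ 2 → ∀ (ℓ d : ℕ) (δ : ℝ), 1 ≤ ℓ → 30 ≤ d → 0 < δ → δ < 1 →
      ∃ ε : ℝ, 0 < ε ∧ ∃ N : ℕ, ∀ n : ℕ, N ≤ n → ∀ (m : ℕ) (E : Fin m → LinEqMod 2 n),
        (∀ i, (E i).supp.card ≤ ℓ) →
        IsBoundaryExpander (fun i => (E i).supp.map Fin.valEmbedding) ((n : ℝ) ^ (1 - δ))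
          (3 / 4 * ℓ) →
        ¬ SystemSat E Finset.univ →
        ∃ π : List (PropFormMod p ℕ), textbookFrege.IsModDepthProofOf d π
            (PropFormMod.ofPropForm (PropForm.neg (PropForm.ofCNF (sumEncoding 1 E)))) ∧
          (2 : ℝ) ^ ((n : ℝ) ^ ε) ≤ (modProofSize π : ℝ) := by
  intro p hp hp2 ℓ d δ hℓ hd hδ hδ1
  obtain ⟨ε, hε, N, hN⟩ := h p hp hp2 ℓ d δ hℓ hδ hδ1
  refine ⟨ε, hε, N, fun n hn m E hsp hexp hunsat => ?_⟩
  obtain ⟨π, hπ⟩ := exists_isModDepthProofOf_sumEncoding p E hunsat hd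
  exact ⟨π, hπ, hN n hn m E hsp hexp hunsat π hπ⟩

end Summit.PneNP.PneNP.Theorems
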